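import Literature.IUT.HodgeArakelov.LabelClassesOfCuspsHomogeneousCount
import Literature.IUT.HodgeArakelov.CuspidalInertiaDataProfiniteOfCoverModel
import Literature.AnabelianGeometry.EtaleTheta.Discharge.Sec2Cor29Model
import Literature.AnabelianGeometry.EtaleTheta.Discharge.Sec2CompletionIndex
import Literature.AnabelianGeometry.SemiGraphs.TemperedCompletionOpenSubgroups
import Literature.AnabelianGeometry.SemiGraphs.TemperedDecompositionOfProfinite
import HarnessLib

/-!
# [IUTchII] Def 2.3 (ii)/(iii) at the GENUINE tower: the profinite cuspidal datum of `Π̂^±_v` is HOMOGENEOUS — its cusps are exactly the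
# `Π̂^cor_v`-conjugates of `J₀ = ι(inclX I_{x₀})` — and the objects `J₀`, `D̂`, `Π̂_X` of the label-class count

S. Mochizuki, *Inter-universal Teichmüller theory II*, kurims manuscript (Dec. 2020), §2 Def 2.3 (ii) p. 68 (cuspidal inertia groups of
`Π̂^±_v`), Rmk 2.3.1 p. 69 («the cuspidal inertia groups … are permuted by the conjugation action of `Π^cor_v`»), Def 2.3 (iii) p. 68
[claim: Mochizuki2012, status: disputed] (IUTchII §2 Def 2.3 (ii), kurims p.68) (D-0012 claim key; record-only).  Inputs in print:
[SemiAnbd] §6 p. 71 (`I_x := D_x ∩ Δ^temp_X`, `I_x ≅ Ẑ(1)`), Thm 6.5 (iii) p. 72 [cite: MochizukiSemiAnbd2006, Thm 6.5(iii) p.72];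
[EtTh] Def 2.1 p. 36 (the inversion of `C = X/±1`), Def 2.5 (i) p. 39 (`X̲ → X`) [cite: MochizukiEtTh2009, Def 2.5 (i) p.39].

abc-iut cell, seat abc-iut-w5-d132 (gen 6), row «DEF23V-CARD-L» (input (ii) of abc-iut-w5-d243's Def 2.3 (v) criterion p440082), part 1 of 2
at abc-iut-L6-t19's genuine tower `PlusMinusTower.ofCoverModel` (p430122) for the PROFINITE cuspidal datum of this seat's p432649
(`exists_cuspidalInertiaDataHat_ofCoverModel`: cusps of `Π̂^±_v` = the `Π̂^±_v`-conjugates of `cl ι((g·inclX I_x·g⁻¹) ∩ inclX Π^tp_{X̲_v})`).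
PROOF-ONLY (no `def`, no instance, no new named fact).  In the ambient `Q = Π̂^cor_v` (ANY injective profinite completion `ι : Π^tp_C → Q`):

* `J₀ := ι(inclX I_{x₀})` is CLOSED (`I_{x₀} ≅ Ẑ(1)` compact, `compactSpace_inertia_of_isCusp`); `J₀ = D̂ ∩ Ker Φ` for `D̂ := ι(inclX D_{x₀})`
  (`Φ ∘ ι ∘ inclX = aug`), `D̂ ≤ N(J₀)`, and `J₀` is stable under every `q` normalising `D̂`;
* `Π̂_X := cl ι(inclX Π^tp_X)` has index `2` and `ι⁻¹(Π̂_X) = Π^tp_X` (abc-iut-L2-t8 / w5-d139 `index_topologicalClosure_map`,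
  `comap_topologicalClosure_map`);
* the INVERSION (`exists_ι_not_mem_closure_conj_map_decomp`): some `ι(g)`, `g ∈ Π^tp_C ∖ Π^tp_X`, lies outside `Π̂_X` and normalises `D̂` —
  abc-iut-L2's `exists_not_mem_range_mem_normalizer_decomp` ([SemiAnbd] Thm 6.5 (iii) `IsoPreservesCuspidalDecomp`, FACT-LIST F-1674,
  BY NAME + the origin clause «unique cusp» `huniq`, [EtTh] Def 2.1 p. 35, abc-iut-L2-t7's `CuspLaws.cusp_unique`);
* **HOMOGENEITY** (`isCuspidalInertia_pmHat_iff`): with ONE cusp `x₀`, `Π^tp_{X̲_v} ⊴ Π^tp_C` (abc-iut-L6-t19 `map_inclX_GtpXu_normal`, mod L02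
  `hZ`) and `Π̂^cor_v = ι(Π^tp_C) · Π̂^±_v` (p432649 `cor_sup_pmHat_eq_top`): a subgroup is a cuspidal inertia group of `Π̂^±_v` for ANY datum
  with the p432649 characterisation IFF it is a `Π̂^cor_v`-conjugate of `J₀`; whence LAW (a) `ConjStable` (G-w5d243-1 (a)) for every such
  datum (`conjStable_ofCoverModel`).

Part 2 (`LabelClassesOfCuspsCardGenuine.lean`) feeds these into the group theory of `LabelClassesOfCuspsHomogeneousCount` to get
`|LabCusp^±(Π̂^±_v)| = l` modulo ONE profinite cusp-separation binder.  HONEST LABEL: theorems about the kernel's genuine tower over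
abc-iut-L2's [EtTh] interface data modulo the printed inputs `hZ` (L02), `hN`, the parameter bundle `op`, «unique cusp» and F-1674;
nothing of the series is asserted; no side taken on [IUTchIII] Cor 3.12; typed ≠ proved; witnessed ≠ endorsed.
-/

noncomputable section

namespace Literature.IUT.HodgeArakelov

open Literature.AnabelianGeometry.EtaleTheta Literature.AnabelianGeometry.SemiGraphs
open scoped Pointwise

/-! ## 0. Generic bookkeeping -/

section Generic

/-- Pushing a conjugate forward: `f(a H a⁻¹) = f(a) f(H) f(a)⁻¹`. [folklore] -/
private theorem map_conj_smul {A B : Type*} [Group A] [Group B] (f : A →* B) (a : A) (H : Subgroup A) :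
    (MulAut.conj a • H).map f = MulAut.conj (f a) • H.map f := by
  rw [conj_smul_eq_map_conj, conj_smul_eq_map_conj, Subgroup.map_map, Subgroup.map_map]
  congr 1
  ext x
  simp [MulAut.conj_apply]

/-- Conjugation commutes with topological closure of subgroups (conjugation is a homeomorphism of the group). [folklore] -/
private theorem conj_smul_topologicalClosure {G : Type*} [Group G] [TopologicalSpace G] [IsTopologicalGroup G]
    (a : G) (H : Subgroup G) : MulAut.conj a • H.topologicalClosure = (MulAut.conj a • H).topologicalClosure := by
  apply SetLike.coe_injective
  rw [Subgroup.coe_pointwise_smul, Subgroup.topologicalClosure_coe, Subgroup.topologicalClosure_coe,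
    Subgroup.coe_pointwise_smul]
  let h : G ≃ₜ G := (Homeomorph.mulLeft a).trans (Homeomorph.mulRight a⁻¹)
  have hh : ∀ s : Set G, MulAut.conj a • s = h '' s := by
    intro s
    ext y
    simp only [Set.mem_smul_set, Set.mem_image, MulAut.smul_def, MulAut.conj_apply]
    constructor
    · rintro ⟨x, hx, rfl⟩; exact ⟨x, hx, rfl⟩
    · rintro ⟨x, hx, rfl⟩; exact ⟨x, hx, rfl⟩
  rw [hh, hh, h.image_closure]

/-- A closed subgroup is its own topological closure. [folklore] -/
private theorem topologicalClosure_eq_of_isClosed {G : Type*} [Group G] [TopologicalSpace G] [IsTopologicalGroup G]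
    (H : Subgroup G) (hH : IsClosed (H : Set G)) : H.topologicalClosure = H :=
  le_antisymm (Subgroup.topologicalClosure_minimal H le_rfl hH) (Subgroup.le_topologicalClosure H)

end Generic

namespace PlusMinusTower

variable {p : ℕ} [Fact p.Prime] {M : MuTwoSetting p} (e : M.CLevelData)
  {E : M.toThetaSetting.EtaleThetaData} {l : ℕ} (C : E.DoubleUnderline l) {N : ℕ+}
  (μ : M.toThetaSetting.CyclotomeMod l N) (hC : M.toThetaSetting.Compat) (hS : M.toThetaSetting.Sec2Hyps)
  (hl : l.Prime) (hp2 : p ≠ 2) (hpl : p ≠ l) (hζ : ∃ ζ : M.toThetaSetting.K, IsPrimitiveRoot ζ (4 * l))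
  {η : (C.thetaEnvData μ hC hS).PiYdd → MuN p N} (hη : η ∈ (C.thetaEnvData μ hC hS).thetaCocycles)
  {Q : Type} [Group Q] [TopologicalSpace Q] [IsTopologicalGroup Q]
  (ι : M.GtpC →ₜ* Q) (hι : IsProfiniteCompletion ι) (hinj : Function.Injective ι)
  (Φ : Q →* GQp p) (hΦ : ∀ g : M.GtpC, Φ (ι g) = e.augC g) (hΦK : Φ.range = M.GK)
  (hZ : Thm16Sub.KerToZIsCompactlyGenerated M.toThetaSetting) (hN : (C.Huu.subgroupOf (M.GtpXu l)).Normal)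
  {P : TopGroup.{0}} (T : TemperedCoverings (BadPlaceSetting.ofUnderline C μ hC hS hl hp2 hpl hζ hη) P)

/-! ## 1. The objects in `Q`: `J₀ = ι(inclX I_{x₀})`, `D̂ = ι(inclX D_{x₀})`, `Π̂_X = cl ι(inclX Π^tp_X)` -/

section Objects

variable {x₀ : M.Pt}

include hι in
omit [IsTopologicalGroup Q] in
/-- `J₀ := ι(inclX I_{x₀})` is CLOSED in `Q`: `I_{x₀} ≅ Ẑ(1)` is compact ([SemiAnbd] §6 p. 71) and `Q` is Hausdorff. [cite: MochizukiSemiAnbd2006, §6 p.71] -/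
theorem isClosed_map_inertia (hx₀ : M.IsCusp x₀) :
    IsClosed ((((M.toTemperedCurve.inertia x₀).map M.inclX).map ι.toMonoidHom : Subgroup Q) : Set Q) := by
  haveI := hι.t2Space
  haveI := M.toTemperedCurve.compactSpace_inertia_of_isCusp hx₀
  have hc : IsCompact ((M.toTemperedCurve.inertia x₀ : Subgroup M.PiTemp) : Set M.PiTemp) :=
    isCompact_iff_compactSpace.mpr inferInstance
  rw [Subgroup.coe_map, Subgroup.coe_map]
  exact ((hc.image M.continuous_inclX).image ι.continuous).isClosed

/-- `I_{x₀} ≤ D_{x₀} ≤ Π^tp_Y ≤ Π^tp_{X̲}` (parameter (P3) of the once-punctured bundle: decomposition groups of cusps lie in `Ker(Π^tp_X ↠ Z)`).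
[cite: MochizukiEtTh2009, §1 p.13] -/
theorem decomp_le_GtpXu (op : M.toThetaSetting.OncePuncturedData) (hx₀ : M.IsCusp x₀) : M.decomp x₀ ≤ M.GtpXu l :=
  (op.decomp_le_ker_toZ x₀ hx₀).trans (M.toThetaSetting.GtpY_le_GtpXu l)

/-- `I_{x₀} ≤ Π^tp_{X̲}`. [cite: MochizukiEtTh2009, §1 p.13] -/
theorem inertia_le_GtpXu (op : M.toThetaSetting.OncePuncturedData) (hx₀ : M.IsCusp x₀) :
    M.toTemperedCurve.inertia x₀ ≤ M.GtpXu l :=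
  (inf_le_left : M.toTemperedCurve.inertia x₀ ≤ M.decomp x₀).trans (decomp_le_GtpXu op hx₀)

include e hZ in
/-- The cusp family of p430433 simplifies: `(g · inclX I_{x₀} · g⁻¹) ∩ inclX Π^tp_{X̲} = g · inclX I_{x₀} · g⁻¹` (`Π^tp_{X̲} ⊴ Π^tp_C`, mod L02).
([IUTchII] Rmk 2.3.1, kurims p.69) [claim: Mochizuki2012, status: disputed] -/
theorem conj_map_inertia_inf_eq (op : M.toThetaSetting.OncePuncturedData) (hx₀ : M.IsCusp x₀) (g : M.GtpC) :
    (MulAut.conj g • (M.toTemperedCurve.inertia x₀).map M.inclX) ⊓ (M.GtpXu l).map M.inclX =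
      MulAut.conj g • (M.toTemperedCurve.inertia x₀).map M.inclX := by
  haveI := e.map_inclX_GtpXu_normal l hZ
  exact inf_eq_left.mpr ((Subgroup.pointwise_smul_le_pointwise_smul_iff.mpr
    (Subgroup.map_mono (inertia_le_GtpXu op hx₀))).trans_eq (Subgroup.Normal.conj_smul_eq_self g _))

include e hZ hι in
/-- **The cusp family IS the conjugates of `J₀`**: `cl ι((g · inclX I_{x₀} · g⁻¹) ∩ inclX Π^tp_{X̲}) = ι(g) · J₀ · ι(g)⁻¹` (no closure: `J₀` is closed).
([IUTchII] Def 2.3 (ii), kurims p.68) [claim: Mochizuki2012, status: disputed] -/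
theorem cuspFamily_closure_eq (op : M.toThetaSetting.OncePuncturedData) (hx₀ : M.IsCusp x₀) (g : M.GtpC) :
    ((((MulAut.conj g • (M.toTemperedCurve.inertia x₀).map M.inclX) ⊓ (M.GtpXu l).map M.inclX).map
        ι.toMonoidHom : Subgroup Q)).topologicalClosure =
      MulAut.conj (ι g) • ((M.toTemperedCurve.inertia x₀).map M.inclX).map ι.toMonoidHom := by
  rw [conj_map_inertia_inf_eq e hZ op hx₀, map_conj_smul, ← conj_smul_topologicalClosure,
    topologicalClosure_eq_of_isClosed _ (isClosed_map_inertia ι hι hx₀)]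
  rfl

include hΦ in
omit [IsTopologicalGroup Q] in
/-- **`J₀ = D̂ ∩ Ker Φ`**: `ι(inclX I_{x₀}) = ι(inclX D_{x₀}) ∩ Ker(Φ)`, because `I_{x₀} = D_{x₀} ∩ Ker(aug)` and `Φ ∘ ι ∘ inclX = aug`.
([SemiAnbd] §6 p.71 «`I_x := D_x ∩ Δ^temp_X`») [cite: MochizukiSemiAnbd2006, §6 p.71] -/
theorem map_inertia_eq_map_decomp_inf_ker :
    (((M.toTemperedCurve.inertia x₀).map M.inclX).map ι.toMonoidHom : Subgroup Q) =
      ((M.decomp x₀).map M.inclX).map ι.toMonoidHom ⊓ Φ.ker := by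
  apply le_antisymm
  · rintro z ⟨z₁, ⟨d, hd, rfl⟩, rfl⟩
    have hd' : d ∈ M.decomp x₀ ⊓ M.toTemperedCurve.DeltaTemp := hd
    refine ⟨⟨M.inclX d, ⟨d, hd'.1, rfl⟩, rfl⟩, ?_⟩
    change Φ (ι (M.inclX d)) = 1
    rw [hΦ, e.augC_inclX]
    exact hd'.2
  · rintro z ⟨⟨z₁, ⟨d, hd, rfl⟩, rfl⟩, hz⟩
    change Φ (ι (M.inclX d)) = 1 at hz
    rw [hΦ, e.augC_inclX] at hz
    exact ⟨M.inclX d, ⟨d, ⟨hd, hz⟩, rfl⟩, rfl⟩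

omit [IsTopologicalGroup Q] in
/-- `D̂ = ι(inclX D_{x₀})` normalises `J₀ = ι(inclX I_{x₀})` (`D_{x₀}` normalises `I_{x₀} = D_{x₀} ∩ Δ^tp_X`). [cite: MochizukiSemiAnbd2006, §6 p.71] -/
theorem map_decomp_le_normalizer_map_inertia :
    (((M.decomp x₀).map M.inclX).map ι.toMonoidHom : Subgroup Q) ≤
      Subgroup.normalizer ((((M.toTemperedCurve.inertia x₀).map M.inclX).map ι.toMonoidHom : Subgroup Q) : Set Q) := by
  rintro z ⟨z₁, ⟨d, hd, rfl⟩, rfl⟩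
  rw [mem_normalizer_iff_conj_smul_eq]
  haveI : M.toTemperedCurve.DeltaTemp.Normal := by unfold TemperedCurve.DeltaTemp; infer_instance
  rw [← map_conj_smul, ← map_conj_smul, TemperedCurve.inertia, Subgroup.smul_inf, Subgroup.conj_smul_eq_self_of_mem hd,
    Subgroup.Normal.conj_smul_eq_self]

include hι in
/-- `Π̂_X := cl ι(inclX Π^tp_X)` has index `2` in `Q` (`[Π^tp_C : Π^tp_X] = 2`; closure preserves the index of an open finite-index subgroup).
[cite: MochizukiEtTh2009, Def 1.7 p.27] -/
theorem index_closure_range_inclX : ((M.inclX.range.map ι.toMonoidHom : Subgroup Q).topologicalClosure).index = 2 := by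
  haveI : M.inclX.range.FiniteIndex := ⟨by rw [M.index_range_inclX]; exact two_ne_zero⟩
  rw [IsProfiniteCompletion.index_topologicalClosure_map hι M.inclX.range M.isOpen_range_inclX, M.index_range_inclX]

include hι in
/-- `ι⁻¹(Π̂_X) = Π^tp_X`: an element of `Π^tp_C ∖ Π^tp_X` stays outside `Π̂_X`. [cite: MochizukiSemiAnbd2006, §6 p.69] -/
theorem mem_closure_range_inclX_iff (g : M.GtpC) :
    ι g ∈ (M.inclX.range.map ι.toMonoidHom : Subgroup Q).topologicalClosure ↔ g ∈ M.inclX.range := by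
  haveI : M.inclX.range.FiniteIndex := ⟨by rw [M.index_range_inclX]; exact two_ne_zero⟩
  have h := IsProfiniteCompletion.comap_topologicalClosure_map hι M.inclX.range M.isOpen_range_inclX
  conv_rhs => rw [← h]
  rfl

include hΦ in
omit [IsTopologicalGroup Q] in
/-- `J₀` is stable under every `q ∈ Q` normalising `D̂` (it is `D̂ ∩ Ker Φ`, `Ker Φ ⊴ Q`). [cite: MochizukiSemiAnbd2006, §6 p.71] -/
theorem conj_smul_map_inertia_of_decomp (q : Q)
    (hq : MulAut.conj q • (((M.decomp x₀).map M.inclX).map ι.toMonoidHom : Subgroup Q) =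
      ((M.decomp x₀).map M.inclX).map ι.toMonoidHom) :
    MulAut.conj q • (((M.toTemperedCurve.inertia x₀).map M.inclX).map ι.toMonoidHom : Subgroup Q) =
      ((M.toTemperedCurve.inertia x₀).map M.inclX).map ι.toMonoidHom := by
  rw [map_inertia_eq_map_decomp_inf_ker e ι Φ hΦ, Subgroup.smul_inf, hq, Subgroup.Normal.conj_smul_eq_self]

include e hι in
/-- **The inversion of `C = X/±1` fixes the cusp, profinitely**: some `ι(g)`, `g ∈ Π^tp_C ∖ Π^tp_X`, lies OUTSIDE `Π̂_X` and normalises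
`D̂ = ι(inclX D_{x₀})` — abc-iut-L2's `exists_not_mem_range_mem_normalizer_decomp` ([SemiAnbd] Thm 6.5 (iii), F-1674, + «unique cusp»)
pushed into `Q`. [cite: MochizukiEtTh2009, Def 2.1 p.36] -/
theorem exists_ι_not_mem_closure_conj_map_decomp (hx₀ : M.IsCusp x₀) (huniq : ∀ x' : M.Pt, M.IsCusp x' → x' = x₀)
    (h65iii : M.toTemperedCurve.IsoPreservesCuspidalDecomp M.toTemperedCurve) :
    ∃ g : M.GtpC, ι g ∉ (M.inclX.range.map ι.toMonoidHom : Subgroup Q).topologicalClosure ∧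
      MulAut.conj (ι g) • (((M.decomp x₀).map M.inclX).map ι.toMonoidHom : Subgroup Q) =
        ((M.decomp x₀).map M.inclX).map ι.toMonoidHom := by
  obtain ⟨g, hgX, hgN⟩ := e.exists_not_mem_range_mem_normalizer_decomp hx₀ huniq h65iii
  refine ⟨g, fun h => hgX ((mem_closure_range_inclX_iff ι hι g).mp h), ?_⟩
  have h := map_conj_smul ι.toMonoidHom g ((M.decomp x₀).map M.inclX)
  rw [mem_normalizer_iff_conj_smul_eq.mp hgN] at h
  exact h.symm

end Objects

/-! ## 2. Homogeneity of the profinite cuspidal datum, and law (a) -/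

section Tower

variable {x₀ : M.Pt}

/-- **HOMOGENEITY.**  For ANY cuspidal datum `CuHat` of the genuine tower with the p432649 characterisation and ONE cusp `x₀` of `X`:
a subgroup `J` is a cuspidal inertia group of `Π̂^±_v` iff `J = q J₀ q⁻¹` for some `q ∈ Π̂^cor_v`, `J₀ = ι(inclX I_{x₀})`
(«cuspidal inertia groups of the normal `Π̂^±_v` are permuted by `Π̂^cor_v`», Rmk 2.3.1; `Π̂^cor_v = ι(Π^tp_C) · Π̂^±_v`).
([IUTchII] Def 2.3 (ii), Rmk 2.3.1, kurims pp.68–69) [claim: Mochizuki2012, status: disputed] -/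
theorem isCuspidalInertia_pmHat_iff (op : M.toThetaSetting.OncePuncturedData) (hx₀ : M.IsCusp x₀)
    (huniq : ∀ x' : M.Pt, M.IsCusp x' → x' = x₀)
    (CuHat : CuspidalInertiaData (ofCoverModel e C μ hC hS hl hp2 hpl hζ hη ι hι hinj Φ hΦ hΦK hZ hN T))
    (hCu : ∀ Q' J : Subgroup (ofCoverModel e C μ hC hS hl hp2 hpl hζ hη ι hι hinj Φ hΦ hΦK hZ hN T).Corhat,
      CuHat.IsCuspidalInertia Q' J ↔ J ≤ Q' ∧ ∃ i : {x : M.Pt // M.IsCusp x} × M.GtpC,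
        ∃ γ ∈ (ofCoverModel e C μ hC hS hl hp2 hpl hζ hη ι hι hinj Φ hΦ hΦK hZ hN T).pmHat,
          J = MulAut.conj γ •
            ((((MulAut.conj i.2 • (M.toTemperedCurve.inertia i.1.1).map M.inclX) ⊓ (M.GtpXu l).map M.inclX).map
              ι.toMonoidHom : Subgroup (ofCoverModel e C μ hC hS hl hp2 hpl hζ hη ι hι hinj Φ hΦ hΦK hZ hN T).Corhat)).topologicalClosure)
    (J : Subgroup (ofCoverModel e C μ hC hS hl hp2 hpl hζ hη ι hι hinj Φ hΦ hΦK hZ hN T).Corhat) :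
    CuHat.IsCuspidalInertia (ofCoverModel e C μ hC hS hl hp2 hpl hζ hη ι hι hinj Φ hΦ hΦK hZ hN T).pmHat J ↔
      ∃ q : (ofCoverModel e C μ hC hS hl hp2 hpl hζ hη ι hι hinj Φ hΦ hΦK hZ hN T).Corhat,
        J = MulAut.conj q • (((M.toTemperedCurve.inertia x₀).map M.inclX).map ι.toMonoidHom :
          Subgroup (ofCoverModel e C μ hC hS hl hp2 hpl hζ hη ι hι hinj Φ hΦ hΦK hZ hN T).Corhat) := by
  -- `ι` valued in `Π̂^cor_v = Q` (bookkeeping: keeps every element `Π̂^cor_v`-typed)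
  let ιW : M.GtpC →* (ofCoverModel e C μ hC hS hl hp2 hpl hζ hη ι hι hinj Φ hΦ hΦK hZ hN T).Corhat := ι.toMonoidHom
  -- every member of the family is a conjugate of `J₀`
  have hfam : ∀ i : {x : M.Pt // M.IsCusp x} × M.GtpC,
      ((((MulAut.conj i.2 • (M.toTemperedCurve.inertia i.1.1).map M.inclX) ⊓ (M.GtpXu l).map M.inclX).map
        ι.toMonoidHom : Subgroup (ofCoverModel e C μ hC hS hl hp2 hpl hζ hη ι hι hinj Φ hΦ hΦK hZ hN T).Corhat)).topologicalClosure =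
      MulAut.conj (ιW i.2) • (((M.toTemperedCurve.inertia x₀).map M.inclX).map ι.toMonoidHom :
        Subgroup (ofCoverModel e C μ hC hS hl hp2 hpl hζ hη ι hι hinj Φ hΦ hΦK hZ hN T).Corhat) := by
    rintro ⟨⟨x, hx⟩, g⟩
    obtain rfl := huniq x hx
    exact cuspFamily_closure_eq e ι hι hZ op hx g
  have hJ₀P : (((M.toTemperedCurve.inertia x₀).map M.inclX).map ι.toMonoidHom :
      Subgroup (ofCoverModel e C μ hC hS hl hp2 hpl hζ hη ι hι hinj Φ hΦ hΦK hZ hN T).Corhat) ≤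
        (ofCoverModel e C μ hC hS hl hp2 hpl hζ hη ι hι hinj Φ hΦ hΦK hZ hN T).pmHat := by
    change (((M.toTemperedCurve.inertia x₀).map M.inclX).map ι.toMonoidHom : Subgroup Q) ≤
      (((M.GtpXu l).map M.inclX).map ι.toMonoidHom).topologicalClosure
    exact (Subgroup.map_mono (Subgroup.map_mono (inertia_le_GtpXu op hx₀))).trans (Subgroup.le_topologicalClosure _)
  rw [hCu]
  constructor
  · rintro ⟨-, i, γ, -, rfl⟩
    exact ⟨γ * ιW i.2, by rw [hfam i, map_mul, mul_smul]⟩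
  · rintro ⟨q, rfl⟩
    -- `q = ι(c) · π` with `π ∈ Π̂^±_v`
    have hq : q ∈ (ofCoverModel e C μ hC hS hl hp2 hpl hζ hη ι hι hinj Φ hΦ hΦK hZ hN T).cor ⊔
        (ofCoverModel e C μ hC hS hl hp2 hpl hζ hη ι hι hinj Φ hΦ hΦK hZ hN T).pmHat := by
      rw [cor_sup_pmHat_eq_top e C μ hC hS hl hp2 hpl hζ hη ι hι hinj Φ hΦ hΦK hZ hN T]; trivial
    rw [← SetLike.mem_coe, Subgroup.mul_normal] at hq
    obtain ⟨c', hc', π, hπ, rfl⟩ := Set.mem_mul.mp hq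
    obtain ⟨c, hc⟩ := (SetLike.mem_coe.mp hc' : c' ∈ (ofCoverModel e C μ hC hS hl hp2 hpl hζ hη ι hι hinj Φ hΦ hΦK hZ hN T).cor)
    replace hπ : π ∈ (ofCoverModel e C μ hC hS hl hp2 hpl hζ hη ι hι hinj Φ hΦ hΦK hZ hN T).pmHat := SetLike.mem_coe.mp hπ
    have hcW : ιW c = c' := hc
    refine ⟨(Subgroup.pointwise_smul_le_pointwise_smul_iff.mpr hJ₀P).trans_eq (Subgroup.Normal.conj_smul_eq_self _ _),
      ⟨⟨x₀, hx₀⟩, c⟩, c' * π * c'⁻¹, ?_, ?_⟩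
    · exact (ofCoverModel e C μ hC hS hl hp2 hpl hζ hη ι hι hinj Φ hΦ hΦK hZ hN T).pmHat_normal.conj_mem π hπ c'
    · rw [hfam, ← mul_smul, ← map_mul]
      change MulAut.conj (c' * π) • _ = MulAut.conj (c' * π * c'⁻¹ * ιW c) • _
      rw [hcW, inv_mul_cancel_right]

/-- **LAW (a) for ANY datum with the p432649 characterisation** (G-w5d243-1 (a), `CuspidalInertiaData.ConjStable`): the cusps of `Π̂^±_v`
are permuted by `Π̂^cor_v`-conjugation — immediate from homogeneity. ([IUTchII] Rmk 2.3.1, kurims p.69) [claim: Mochizuki2012, status: disputed] -/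
theorem conjStable_ofCoverModel (op : M.toThetaSetting.OncePuncturedData) (hx₀ : M.IsCusp x₀)
    (huniq : ∀ x' : M.Pt, M.IsCusp x' → x' = x₀)
    (CuHat : CuspidalInertiaData (ofCoverModel e C μ hC hS hl hp2 hpl hζ hη ι hι hinj Φ hΦ hΦK hZ hN T))
    (hCu : ∀ Q' J : Subgroup (ofCoverModel e C μ hC hS hl hp2 hpl hζ hη ι hι hinj Φ hΦ hΦK hZ hN T).Corhat,
      CuHat.IsCuspidalInertia Q' J ↔ J ≤ Q' ∧ ∃ i : {x : M.Pt // M.IsCusp x} × M.GtpC,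
        ∃ γ ∈ (ofCoverModel e C μ hC hS hl hp2 hpl hζ hη ι hι hinj Φ hΦ hΦK hZ hN T).pmHat,
          J = MulAut.conj γ •
            ((((MulAut.conj i.2 • (M.toTemperedCurve.inertia i.1.1).map M.inclX) ⊓ (M.GtpXu l).map M.inclX).map
              ι.toMonoidHom : Subgroup (ofCoverModel e C μ hC hS hl hp2 hpl hζ hη ι hι hinj Φ hΦ hΦK hZ hN T).Corhat)).topologicalClosure) :
    CuHat.ConjStable := by
  rw [CuspidalInertiaData.conjStable_iff_smul]
  intro g I hI
  rw [isCuspidalInertia_pmHat_iff e C μ hC hS hl hp2 hpl hζ hη ι hι hinj Φ hΦ hΦK hZ hN T op hx₀ huniq CuHat hCu] at hI ⊢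
  obtain ⟨q, rfl⟩ := hI
  exact ⟨g * q, by rw [map_mul, mul_smul]⟩

end Tower

end PlusMinusTower

end Literature.IUT.HodgeArakelov

end
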